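import Summits.Ventures.CertifiedArithmetic.LowPrec.SRMonotone
import HarnessLib

/-!
# Stochastic rounding into a finite format, XXII: sure certificates give exactly zero saturation

HONEST FRAMING: certified error envelopes and provably optimal rounding/accumulation schemes for
low-precision formats under stated cost models; every table by two implementations; no hardware or
vendor claims.

Venture CertifiedArithmetic / lowprec, SR slice (gen5).  The missing link between the DETERMINISTIC
hull certificates of files I/VI (`NoSatT`, and the `O(m)` interval certificate `HullCert` of
`SRTreeIntervals.lean`) and the PROBABILISTIC saturation objects of files X/XVIII (`satProbT`,
`exitE`): a sure certificate makes the saturation probability EXACTLY zero, for every substrate, every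
tree shape and every exit predicate.

* `NoExitT F e T` — on every rounding branch no node's pre-rounding value satisfies `e`;
  `treeExpE_eq_treeExp_of_noExitT`: then the flagged law forgets the flag, `exitE F e T = 0`
  (`exitE_eq_zero_of_noExitT`);
* `noExitT_sat_of_noSatT`: `NoSatT` is `NoExitT` for the saturation predicate, hence
  **`satProbT_eq_zero_of_noSatT`** and, via `noSatT_of_hullCert`, **`satProbT_eq_zero_of_hullCert`**:
  the `O(m)` range-propagation certificate (two hull tests per node) certifies `P(sat) = 0` exactly —
  no dynamic programme, no enumeration.

This is the cheap explanation of the 27 rows `P(sat) = 0` of the exact law table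
`certs/sr/gen5/EXACT_cases_{A,B}.csv` (21 balanced, 6 short sequential): on the 44 named vectors
the interval certificate holds EXACTLY on those 27 rows (`code/sr/gen5/hullcert_check.py`, 44/44).
E.g. E3M2, sawtooth data, balanced, 16 leaves — the certificate holds (root range
`[20, 24] ⊂ [−28, 28]`), kernel instance `SureE3M2.sawBal16_noSat` below; the sequential order of the
same data fails it and saturates with probability `0.0862` (file XXI).
-/

namespace Summit.Ventures.CertifiedArithmetic.LowPrec.SR

open Literature.ComputerArithmetic.ConnollyHighamMary2021 Finset STree

variable {K : Type*} [Field K] [LinearOrder K] [IsStrictOrderedRing K]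

/-! ### No branch ever fires the exit predicate -/

/-- `NoExitT F e T`: on every rounding branch, no node's pre-rounding value `a + b` satisfies `e`. -/
def NoExitT (F : Finset K) (e : K → Bool) : STree K → Prop
  | .leaf _ => True
  | .node l r => NoExitT F e l ∧ NoExitT F e r
      ∧ AllOut F l (fun a => AllOut F r (fun b => e (a + b) = false))

omit [IsStrictOrderedRing K] in
/-- Under `NoExitT` the flagged law forgets the flag: `E ψ(ŝ, flag) = E ψ(ŝ, false)`. -/
theorem treeExpE_eq_treeExp_of_noExitT (F : Finset K) (e : K → Bool) :
    ∀ (T : STree K), NoExitT F e T → ∀ (φ : K → Bool → K),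
      treeExpE F e T φ = treeExp F T (fun v => φ v false)
  | .leaf _, _, _ => rfl
  | .node l r, ⟨hl, hr, hlr⟩, φ => by
      simp only [treeExpE, treeExp]
      rw [treeExpE_eq_treeExp_of_noExitT F e l hl]
      refine treeExp_congr_of_allOut F l (allOut_mono F l (fun a ha => ?_) hlr)
      rw [treeExpE_eq_treeExp_of_noExitT F e r hr]
      refine treeExp_congr_of_allOut F r (allOut_mono F r (fun b hb => ?_) ha)
      simp [hb]

omit [IsStrictOrderedRing K] in
/-- **Sure certificate ⇒ exit probability exactly `0`.** -/
theorem exitE_eq_zero_of_noExitT (F : Finset K) (e : K → Bool) (T : STree K) (h : NoExitT F e T) :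
    exitE F e T = 0 := by
  unfold exitE
  rw [treeExpE_eq_treeExp_of_noExitT F e T h]
  exact treeExp_const F T 0

omit [IsStrictOrderedRing K] in
/-- `NoSatT F T` is `NoExitT` for the saturation predicate `outB F` ("outside the hull"). -/
theorem noExitT_sat_of_noSatT (F : Finset K) : ∀ T : STree K, NoSatT F T → NoExitT F (outB F) T
  | .leaf _, _ => trivial
  | .node l r, ⟨hl, hr, hlr⟩ =>
      ⟨noExitT_sat_of_noSatT F l hl, noExitT_sat_of_noSatT F r hr,
        allOut_mono F l (fun _ ha => allOut_mono F r (fun _ hb => (outB_eq_false_iff F _).mpr hb) ha)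
          hlr⟩

omit [IsStrictOrderedRing K] in
/-- **`NoSatT` ⇒ `P(sat) = 0` exactly** (every substrate, every tree shape). -/
theorem satProbT_eq_zero_of_noSatT (F : Finset K) (T : STree K) (h : NoSatT F T) :
    satProbT F T = 0 := by
  unfold satProbT exitProb
  rw [treeExpF_eq_treeExpE]
  exact exitE_eq_zero_of_noExitT F (outB F) T (noExitT_sat_of_noSatT F T h)

/-- **The `O(m)` interval certificate certifies `P(sat) = 0` exactly.** -/
theorem satProbT_eq_zero_of_hullCert {F : Finset K} (hF : F.Nonempty) (T : STree K)
    (h : HullCert F T) : satProbT F T = 0 :=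
  satProbT_eq_zero_of_noSatT F T (noSatT_of_hullCert hF T h)

/-- Under a sure certificate the mean is unbiased AND no branch saturates: the two gen1/gen4 facts
side by side (`treeBias = 0`, `P(sat) = 0`). -/
theorem bias_and_sat_zero_of_hullCert {F : Finset K} (hF : F.Nonempty) (T : STree K)
    (h : HullCert F T) : treeBias F T = 0 ∧ satProbT F T = 0 :=
  ⟨treeBias_eq_zero_of_noSatT F T (noSatT_of_hullCert hF T h), satProbT_eq_zero_of_hullCert hF T h⟩

/-! ### Kernel instance (FP6): the balanced sawtooth row -/

namespace SureE3M2

/-- gen4's sawtooth test data `x_i = 1 + (i mod 4)/4`. -/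
def saw4 (i : ℕ) : ℚ := 1 + ((i % 4 : ℕ) : ℚ) / 4

/-- The balanced (pairwise) summation tree over `x₀, …, x₁₅` (exact sum `22`). -/
def sawBal16 : STree ℚ := balT saw4 0 4

/-- The `O(m)` interval certificate holds for the balanced sawtooth tree in E3M2 (31 hull tests; the
root's pre-rounding range is `[20, 24] ⊂ [−28, 28]`). -/
theorem sawBal16_hullCert : HullCert Formats.e3m2 sawBal16 := by decide +kernel

/-- **Row `e3m2:saw4:bal:16` of the exact-law table, certified WITHOUT the DP: `P(sat) = 0` and the
pairwise SR sum is unbiased.** -/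
theorem sawBal16_noSat : satProbT Formats.e3m2 sawBal16 = 0 ∧ treeBias Formats.e3m2 sawBal16 = 0 := by
  have hF : Formats.e3m2.Nonempty := ⟨0, by decide +kernel⟩
  exact ⟨satProbT_eq_zero_of_hullCert hF _ sawBal16_hullCert,
    (bias_and_sat_zero_of_hullCert hF _ sawBal16_hullCert).1⟩

/-- By contrast the interval certificate FAILS for the recursive order of the same data (the running
upper range passes `28` — and indeed `P(sat) = 46294165/2^29 > 0` there, file XXI). -/
theorem sawSeq16_not_hullCert : ¬ HullCert Formats.e3m2 (comb (fun k => saw4 (k + 1)) (saw4 0) 15) := by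
  decide +kernel

end SureE3M2

end Summit.Ventures.CertifiedArithmetic.LowPrec.SR
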